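import Mathlib
import HarnessLib
import HarnessLib.Audit
import Summits.AtomisticToContinuum.Statement
import HarnessLib.Audit.Status.Attr

/-!
Route: ResponseFloorAndLimit

# Route ResponseFloorAndLimit — Fourier's law is exactly bounded response plus existence of the
limit plus a uniform conductance floor

ROOT-DECOMPOSITION NODE N_F.A of cell decomp-a2c (D-0178/D-0179; writer-originated, no lens covered
the conjunct; refines the
definitional root node N0 `AtomisticToContinuum = HL ∧ FL ∧ Cr ∧ BEC`, which D-0017 forbids as a
route file). It suffices to show
X = BR ∧ RLE ∧ REP: (BR) the finite-N response coefficients D_N(T) of the pinned anharmonic chain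
are bounded uniformly in N;
(RLE) a bounded response sequence converges as N → ∞; (REP) the response has a uniform eventual
positive floor ∃ c > 0, D_N ≥ c.
The node is EXACT: `FouriersLaw ↔ BR ∧ RLE ∧ REP` is kernel-proved in the cell file (necessity of
each piece by uniqueness of limits;
sufficiency = `closes`) over the three PROVED finite-N supports NessUnique (stmt-0741),
PinnedSteadyStateExists (9900),
FiniteResponseOfUnique (0717), restated verbatim. CLEARED by the cell critic (CRITIC-LEDGER row 5
(CLEARED 2026-08-30T01:48:53Z): necessity ✓ kernel ×3, EXACT, no EQUIV layer, typing read-back ✓,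
DISTRIBUTED ✓ with the caveat that this is the logical limsup / lim / liminf split of `D_N → κ(T) ∈
(0,∞)`, earning WEAKER×3 only because the three halves are three different obstruction classes in
print). HONEST WEAKNESS (writer + critic): no piece is attackable NOW by a named technique (census
§4: (ii) is open for every deterministic anharmonic bulk); the node's value is the exact isolation +
three instrument lanes on ONE kit run (critic test T6 = census M8: NEMD of pinnedChain at 2–3
parameter points, T ∈ {0.5, 1, 2}, N ∈ {64,…,4096}, N·J_N/δT vs N with error bars, 20–40 core-h). In
substance BR ∧ RLE carry most of (ii) (declared tribunal residual), REP is the smaller third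
(attacked). Census data: COSTUME-CENSUS-v1.md sha256
df908c62fe1f5e4270d273ba933c48f7c8c23582e7b01247e7a6b0699b9f3e46 (§4, rows F0–F8, M8).
Lean: `BoundedResponse ∧ ResponseLimitExists ∧ ResponseEventuallyPositive`

## Assembly
Pure logic plus uniqueness of limits (kernel-proved as `closes` in glue.lean, 0 sorry): fix
parameters; NessUnique gives clause (i) with
PinnedSteadyStateExists; choose the steady-state family and its response coefficients by
FiniteResponseOfUnique; BoundedResponse bounds them,
ResponseLimitExists gives the limit k, ResponseEventuallyPositive gives c > 0 ≤ D_N eventually hence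
k ≥ c > 0; κ(T) := k is family-independent
by NessUnique (the δ-limits agree eventually in δ).

Rationale: WHY THIS LINE. Part (i) of the conjunct (NESS existence/uniqueness at every N) is proved in tree
(EckmannPilletReyBellet1999, CuneoEckmannHairerReyBellet2018
line of work); part (ii) `N·J_N/δT → κ(T) ∈ (0, ∞)` is open for every deterministic anharmonic bulk
(BonettoLebowitzReyBellet2000 §5). Every
FL route in the tree (LocalOhmBV, FeketeResistance, KineticCorner, FourierGreenKubo …) passes
through the same two-clause frame; this node
records the frame itself as the conjunct's residual split of record, with each piece's necessity
KERNEL-certified, and separates the three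
obstruction classes that the literature treats with different tools: an N-uniform UPPER bound
(finite conductivity; hypocoercive / entropy-production
bounds, BeckerMenegaki2022, Menegaki2020), EXISTENCE of the thermodynamic limit of the response
(subadditivity / ergodic structure,
BonettoLebowitzLukkarinen2004 for the self-consistent model), and an N-uniform LOWER bound (positive
conductivity; the insulating mechanisms of
the anticontinuum / strong-pinning regime are the obstruction class, DeRoeckHuveneers2015,
CuneoEckmannHairerReyBellet2018). No area is
imported; the line is bookkeeping for the decomposition tree, and says so. Why novel: no FL route
states BR or a conductance floor as a
load-bearing binder (LocalOhmBV derives BR from LocalOhm × BVProfile; 9141 bundles limit and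
positivity); here the three are isolated and the
iff is proved.

RANKED CRUXES. #2 BoundedResponse (crux) — for all chain parameters ω₂, lam, β, γ > 0, under
finite-N NESS uniqueness, for every steady-state family μ, every T > 0 and every sequence D of
finite-N response coefficients D_N(T) = lim_{δ→0} (total current of μ_{N,T±δ/2})/δ, the set of |D_N|
is bounded above (verbatim LocalOhmBV.BoundedResponse, stmt-AtomisticToContinuum-10924). PIECE TAG
WEAKER (necessity kernel `boundedResponse_of_fouriersLaw`; sufficiency unknown). LEAF IDEA-NEEDED +
INSTRUMENTABLE (census M8 / critic T6 plateau) + BARRIER-adjacent (FixedLengthNoConductivityControl,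
SpectralGapClosing: fixed-N spectral methods give no N-uniformity — an obstruction to the obvious
attack, not to the statement). Declared tribunal RESIDUAL. Critic verdict: CRITIC-LEDGER row 5
(CLEARED 2026-08-30T01:48:53Z). [difficulty: open-problem] (why it might fail: it is the
finite-conductivity half of Fourier's law, open since BLR2000; a bounded-but-anomalous (κ_N ~ log N)
pinned quartic chain is not excluded by any theorem, only by numerics (Aoki–Kusnezov,
Lepri–Livi–Politi).) [BonettoLebowitzReyBellet2000, BeckerMenegaki2022, Menegaki2020,
AokiLukkarinenSpohn2006]
#3 ResponseLimitExists (crux) — for all chain parameters ω₂, lam, β, γ > 0, under finite-N NESS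
uniqueness, for every steady-state family μ, every T > 0 and every sequence D of finite-N response
coefficients D_N(T) = lim_{δ→0} (total current of μ_{N,T±δ/2})/δ, if |D_N| is bounded then D_N
converges to some real k. PIECE TAG WEAKER (necessity kernel `responseLimitExists_of_fouriersLaw`;
alone silent on positivity and on unbounded families). LEAF IDEA-NEEDED + INSTRUMENTABLE (census M8
/ critic T6: monotonicity / drift of D_N in N, the candidate invariant named there). Declared
tribunal RESIDUAL. Critic verdict: CRITIC-LEDGER row 5 (CLEARED 2026-08-30T01:48:53Z). [difficulty:
open-problem] (why it might fail: existence of the N → ∞ limit needs an almost-additive structure of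
the chain's resistance (Fekete-type) or convergence of Green–Kubo; an oscillating bounded response
(even/odd N, commensurability with the pinning) is conceivable and untested.)
[BonettoLebowitzReyBellet2000, BonettoLebowitzLukkarinen2004, BernardinOlla2005]
#4 ResponseEventuallyPositive (crux) — for all chain parameters ω₂, lam, β, γ > 0, under finite-N
NESS uniqueness, for every steady-state family μ, every T > 0 and every sequence D of finite-N
response coefficients D_N(T) = lim_{δ→0} (total current of μ_{N,T±δ/2})/δ, there is c > 0 with c ≤
D_N for all large N (a uniform conductance floor; not conditional on boundedness). PIECE TAG WEAKER
(necessity kernel `responseEventuallyPositive_of_fouriersLaw`, c = κ(T)/2; alone silent on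
finiteness and convergence). LEAF IDEA-NEEDED with a partial ATTACKABLE lane (per-N positivity D_N >
0 = FeketeSeriesLaw.PositiveConductance stmt-11750; the N-uniformity is the open step) +
INSTRUMENTABLE (M8 / T6 floor). ATTACKED piece of the node (the smaller third). Critic verdict:
CRITIC-LEDGER row 5 (CLEARED 2026-08-30T01:48:53Z). [difficulty: open-problem] (why it might fail:
at strong pinning / weak coupling the chain is nearly insulating (anticontinuum localisation,
breathers); a floor uniform in N for fixed positive parameters is believed but no rigorous lower
bound on N·J_N/δT exists for any anharmonic deterministic bulk.) [DeRoeckHuveneers2015,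
CuneoEckmannHairerReyBellet2018, BonettoLebowitzReyBellet2000]
#9 NessUnique (support) — finite-N NESS uniqueness for the pinned chain at all positive parameters
and bath temperatures (verbatim LocalOhmBV.NessUnique, stmt-0741, PROVED). PIECE TAG COSTUME(cite:
NessUnique_holds); critic row 5 ✓. [difficulty: provable-now] [CuneoEckmannHairerReyBellet2018,
EckmannPilletReyBellet1999]
#9 PinnedSteadyStateExists (support) — finite-N NESS existence (verbatim
LocalOhmBV.PinnedSteadyStateExists, stmt-9900, PROVED). PIECE TAG COSTUME(cite: the landed proof of
9900); critic row 5 ✓. [difficulty: provable-now] [EckmannPilletReyBellet1999,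
CuneoEckmannHairerReyBellet2018]
#9 FiniteResponseOfUnique (support) — existence of the finite-N response coefficient D_N(T) along
every steady-state family under uniqueness (verbatim LocalOhmBV.FiniteResponseOfUnique, stmt-0717,
PROVED). PIECE TAG COSTUME(cite: the landed proof of 0717); critic row 5 ✓. [difficulty:
provable-now] [BonettoLebowitzReyBellet2000]

TWO-LAYER PLAN. BR ⇐ LocalOhm → BVProfile → BR (the LocalOhmBV mechanism, glue
`boundedResponse_of_localOhm_bv` already proved there); RLE ⇐ QuasiSubadditiveResistance →
RLE (FeketeResistance); REP ⇐ PositiveConductance (per N) → a uniform Dirichlet-form lower bound →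
REP. Nothing of this is filed now.

KILL CRITERIA. A parameter point (ω₂, lam, β, γ, T) at which N·J_N/δT is certified unbounded refutes
BoundedResponse and the conjunct (close refuted:BoundedResponse);
a certified vanishing floor refutes ResponseEventuallyPositive and the conjunct; an oscillating
bounded response refutes ResponseLimitExists only
as typed per family — all three are necessary, so any refutation refutes FouriersLaw itself
(negative knowledge for the summit).

NOT DECOMPOSED YET. The mechanisms (local Ohm law, bounded-variation temperature profile, Green–Kubo
convergence, resistance subadditivity) — they are the live/dormant
FL routes' cruxes and attach under the three pieces later; temperature dependence of κ; any regime
split in (ω₂, lam, β, γ).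

CHEAPEST FALSIFIER. Census M8 (NEMD of pinnedChain ω₂=lam=β=γ=1, N ∈ [64, 4096], T ∈ {0.5, 1, 2}): a
non-plateauing N·J_N/δT (log-growth) would make BR implausible
at that point; an even/odd-N oscillation would hit RLE; a decaying floor would hit REP. Classical
numerics (Aoki–Kusnezov 2000, Lepri–Livi–Politi 2003)
show a plateau for pinned quartic chains — evidential only (barrier
FixedLengthNoConductivityControl). Not run by this seat (kit not allowed).

NUMBERS. Items at open: 7 (3 cruxes, 3 proved supports, 1 assembly). No constants claimed.

DEFINITION REQUESTS. None.

Novelty: Searches (2026-08-30): tree search `rg BoundedResponse|HasBoundedResponse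
Summits/AtomisticToContinuum/FouriersLaw/Theses` (BR is a support of LocalOhmBV only, derived there;
9141 BoundedResponseConverges bundles limit + positivity; no route has a floor piece); census
COSTUME-CENSUS-v1 §4/F0–F8 (no print result implies (ii));
ledger negatives --problem AtomisticToContinuum (24; FL negatives 13511 OddChargeExists, 9139
OddCorrectorDecay, 12890 FarFieldGaussianity — none is a piece here).
Nearest prior art found: route LocalOhmBV (same frame, BR derived from LocalOhm × BVProfile), route
FeketeResistance (limit via quasi-subadditivity), BonettoLebowitzReyBellet2000 §5 (the two-clause
statement).
Delta: the exact three-way isolation upper bound / existence of limit / lower bound with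
kernel-proved necessity of each piece, as the decomposition node of record for the conjunct —
bookkeeping, not a mechanism.
Claimed grade: known  [refs: BonettoLebowitzReyBellet2000]

Barriers (technique_class: root-decomposition, ness-response-bounds): - technique_class: root-decomposition, ness-response-bounds
- Literature.Barriers.AtomisticToContinuum.HasBoundedResponse: (FixedLengthNoConductivityControl)
applies to BR/RLE/REP alike — every piece is an N-UNIFORM statement, so fixed-N analysis cannot
close any of them; the node does not evade it, it names it as the common obstruction (BR is
literally `HasBoundedResponse` along steady-state families).
- Literature.Barriers.AtomisticToContinuum.BeckerMenegaki2022_gapClosing: (SpectralGapClosing) bites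
any proof of BR via N-uniform spectral gaps — the gap closes polynomially in N; the node takes no
position on the mechanism.
- Literature.Barriers.AtomisticToContinuum.HarmonicChainBallisticFlux: (HarmonicCrystalBallistic)
the harmonic point lam = β = 0 violates BR (N·J_N → ∞,
`HarmonicChainBallisticFlux.not_hasBoundedResponse`) while satisfying a floor — a separating
instance showing REP is strictly weaker than the conjunct in the sibling model; the route's
parameters are strictly anharmonic (lam, β > 0).
- Literature.Barriers.AtomisticToContinuum.AnticontinuumLocalizationNarrow: (with
DeRoeckHuveneers2015_thm2) the obstruction class for REP (near-insulating regimes at weak coupling /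
strong pinning); fixed positive parameters are outside its asymptotic regime but no floor theorem
exists.
- Literature.Barriers.AtomisticToContinuum.BoundaryTapNormPersistence: boundary taps cannot drain an
extensive norm in bounded time — bites relaxation-rate attacks on BR/RLE, not the statemen

sub-problem: FouriersLaw · status: open · opened planner-decomp-a2c-writer-1-g0-0 2026-08-30T01:52:52Z · rev 0 · ledger route-AtomisticToContinuum-ResponseFloorAndLimit
GENERATED by the gate from the ledger (D-0016/17). Provers cite these decls: `theorem foo : Summit.AtomisticToContinuum.FouriersLaw.Theses.ResponseFloorAndLimit.<Decl> := …` in Summits/AtomisticToContinuum/FouriersLaw/Theorems/<Name>.lean.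
-/

namespace Summit.AtomisticToContinuum.FouriersLaw.Theses.ResponseFloorAndLimit

open scoped BigOperators Topology Manifold Classical MeasureTheory ProbabilityTheory Matrix InnerProductSpace ComplexConjugate ContinuousMap
open Filter Set Function TopologicalSpace MeasureTheory

attribute [summit_statement] _root_.FouriersLaw

/-- item stmt-AtomisticToContinuum-10924 · crux · rank 2 · open · by planner
why it might fail: it is the finite-conductivity half of Fourier's law, open since BLR2000; a bounded-but-anomalous (κ_N ~ log N) pinned quartic chain is not excluded by any theorem, only by numerics (Aoki–Kusnezov, Lepri–Livi–Politi).
sources: BonettoLebowitzReyBellet2000, BeckerMenegaki2022, Menegaki2020, AokiLukkarinenSpohn2006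
[support] (= the catalogued necessary waypoint
`Literature.Barriers.AtomisticToContinuum.HasBoundedResponse (pinnedChain ω₂ lam β γ)` under
weak-NESS uniqueness, WRITTEN OUT — definiens verbatim, `hasBoundedResponse_iff` is `Iff.rfl`, so
the old and new decls are definitionally equal (planner Sketch.lean: `example : BoundedResponseR ↔
BoundedResponse := Iff.rfl`, rc 0); provers may still go through `hasBoundedResponse_iff_of_unique`
(PROVED) by importing FixedLengthNoConductivityControl in their Theorems file) for all parameters >
0, assuming uniqueness of weak steady states (IsSteadyState class), along EVERY steady-state family
μ and every T > 0: if D_N = lim_{δ→0, δ≠0} totalCurrent(μ_{N,T+δ/2,T−δ/2})/δ exists for all N then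
(|D_N|)_N is bounded — BLR2000 §6.3's missing 'dependence of D on L' in its weakest quantitative
form; closed in this route by OddSufficiency from OddResponseBound (one Cauchy–Schwarz). Cone repair
2026-08-15 (rev 3): the Barriers PREDICATE carried [cite] doc tags and no `_holds` (it is
vocabulary, explicit binder P), so the staffability audit (#h21_route_deps) listed it as an unproved
cite-only dependency; unfolding removes the name from the decl cone without -/
@[route_item "route-AtomisticToContinuum-ResponseFloorAndLimit", crux]
def BoundedResponse : Prop :=
  ∀ ω₂ lam β γ : ℝ, 0 < ω₂ → 0 < lam → 0 < β → 0 < γ → (∀ (N : ℕ) (T_L T_R : ℝ), 0 < T_L → 0 < T_R → ∀ μ ν : MeasureTheory.Measure (Literature.MathematicalPhysics.KineticTheory.HeatConduction.PhaseSpace N), (Literature.MathematicalPhysics.KineticTheory.HeatConduction.pinnedChain ω₂ lam β γ).IsSteadyState N T_L T_R μ → (Literature.MathematicalPhysics.KineticTheory.HeatConduction.pinnedChain ω₂ lam β γ).IsSteadyState N T_L T_R ν → μ = ν) → ∀ μ : (N : ℕ) → ℝ → ℝ → MeasureTheory.Measure (Literature.MathematicalPhysics.KineticTheory.HeatConduction.PhaseSpace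 N), (∀ (N : ℕ) (T_L T_R : ℝ), 0 < T_L → 0 < T_R → (Literature.MathematicalPhysics.KineticTheory.HeatConduction.pinnedChain ω₂ lam β γ).IsSteadyState N T_L T_R (μ N T_L T_R)) → ∀ T : ℝ, 0 < T → ∀ D : ℕ → ℝ, (∀ N : ℕ, Filter.Tendsto (fun δ : ℝ => (Literature.MathematicalPhysics.KineticTheory.HeatConduction.pinnedChain ω₂ lam β γ).totalCurrent (μ N (T + δ / 2) (T - δ / 2)) / δ) (nhdsWithin 0 {(0 : ℝ)}ᶜ) (nhds (D N))) → BddAbove (Set.range fun N => |D N|)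

/-- item stmt-AtomisticToContinuum-24580 · crux · rank 3 · open · by planner
why it might fail: existence of the N → ∞ limit needs an almost-additive structure of the chain's resistance (Fekete-type) or convergence of Green–Kubo; an oscillating bounded response (even/odd N, commensurability with the pinning) is conceivable and untested.
sources: BonettoLebowitzReyBellet2000, BonettoLebowitzLukkarinen2004, BernardinOlla2005
[crux] for all chain parameters ω₂, lam, β, γ > 0, under finite-N NESS uniqueness, for every
steady-state family μ, every T > 0 and every sequence D of finite-N response coefficients D_N(T) =
lim_{δ→0} (total current of μ_{N,T±δ/2})/δ, if |D_N| is bounded then D_N converges to some real k.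
PIECE TAG WEAKER (necessity kernel `responseLimitExists_of_fouriersLaw`; alone silent on positivity
and on unbounded families). LEAF IDEA-NEEDED + INSTRUMENTABLE (census M8 / critic T6: monotonicity /
drift of D_N in N, the candidate invariant named there). Declared tribunal RESIDUAL. Critic verdict:
CRITIC-LEDGER row 5 (CLEARED 2026-08-30T01:48:53Z). [difficulty: open-problem] -/
@[route_item "route-AtomisticToContinuum-ResponseFloorAndLimit", crux]
def ResponseLimitExists : Prop :=
  ∀ ω₂ lam β γ : ℝ, 0 < ω₂ → 0 < lam → 0 < β → 0 < γ → (∀ (N : ℕ) (T_L T_R : ℝ), 0 < T_L → 0 < T_R → ∀ μ ν : MeasureTheory.Measure (Literature.MathematicalPhysics.KineticTheory.HeatConduction.PhaseSpace N), (Literature.MathematicalPhysics.KineticTheory.HeatConduction.pinnedChain ω₂ lam β γ).IsSteadyState N T_L T_R μ → (Literature.MathematicalPhysics.KineticTheory.HeatConduction.pinnedChain ω₂ lam β γ).IsSteadyState N T_L T_R ν → μ = ν) → ∀ μ : (N : ℕ) → ℝ → ℝ → MeasureTheory.Measure (Literature.MathematicalPhysics.KineticTheory.HeatConduction.PhaseSpace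 N), (∀ (N : ℕ) (T_L T_R : ℝ), 0 < T_L → 0 < T_R → (Literature.MathematicalPhysics.KineticTheory.HeatConduction.pinnedChain ω₂ lam β γ).IsSteadyState N T_L T_R (μ N T_L T_R)) → ∀ T : ℝ, 0 < T → ∀ D : ℕ → ℝ, (∀ N : ℕ, Filter.Tendsto (fun δ : ℝ => (Literature.MathematicalPhysics.KineticTheory.HeatConduction.pinnedChain ω₂ lam β γ).totalCurrent (μ N (T + δ / 2) (T - δ / 2)) / δ) (nhdsWithin 0 {(0 : ℝ)}ᶜ) (nhds (D N))) → BddAbove (Set.range fun N => |D N|) → ∃ k : ℝ, Filter.Tendsto D Filter.atTop (nhds k)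

/-- item stmt-AtomisticToContinuum-24581 · crux · rank 4 · open · by planner
why it might fail: at strong pinning / weak coupling the chain is nearly insulating (anticontinuum localisation, breathers); a floor uniform in N for fixed positive parameters is believed but no rigorous lower bound on N·J_N/δT exists for any anharmonic deterministic bulk.
sources: DeRoeckHuveneers2015, CuneoEckmannHairerReyBellet2018, BonettoLebowitzReyBellet2000
[crux] for all chain parameters ω₂, lam, β, γ > 0, under finite-N NESS uniqueness, for every
steady-state family μ, every T > 0 and every sequence D of finite-N response coefficients D_N(T) =
lim_{δ→0} (total current of μ_{N,T±δ/2})/δ, there is c > 0 with c ≤ D_N for all large N (a uniform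
conductance floor; not conditional on boundedness). PIECE TAG WEAKER (necessity kernel
`responseEventuallyPositive_of_fouriersLaw`, c = κ(T)/2; alone silent on finiteness and
convergence). LEAF IDEA-NEEDED with a partial ATTACKABLE lane (per-N positivity D_N > 0 =
FeketeSeriesLaw.PositiveConductance stmt-11750; the N-uniformity is the open step) + INSTRUMENTABLE
(M8 / T6 floor). ATTACKED piece of the node (the smaller third). Critic verdict: CRITIC-LEDGER row 5
(CLEARED 2026-08-30T01:48:53Z). [difficulty: open-problem] -/
@[route_item "route-AtomisticToContinuum-ResponseFloorAndLimit", crux]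
def ResponseEventuallyPositive : Prop :=
  ∀ ω₂ lam β γ : ℝ, 0 < ω₂ → 0 < lam → 0 < β → 0 < γ → (∀ (N : ℕ) (T_L T_R : ℝ), 0 < T_L → 0 < T_R → ∀ μ ν : MeasureTheory.Measure (Literature.MathematicalPhysics.KineticTheory.HeatConduction.PhaseSpace N), (Literature.MathematicalPhysics.KineticTheory.HeatConduction.pinnedChain ω₂ lam β γ).IsSteadyState N T_L T_R μ → (Literature.MathematicalPhysics.KineticTheory.HeatConduction.pinnedChain ω₂ lam β γ).IsSteadyState N T_L T_R ν → μ = ν) → ∀ μ : (N : ℕ) → ℝ → ℝ → MeasureTheory.Measure (Literature.MathematicalPhysics.KineticTheory.HeatConduction.PhaseSpace N), (∀ (N : ℕ) (T_L T_R : ℝ), 0 < T_L → 0 < T_R → (Literature.MathematicalPhysics.KineticTheory.HeatConduction.pinnedChain ω₂ lam β γ).IsSteadyState N T_L T_R (μ N T_L T_R)) → ∀ T : ℝ, 0 < T → ∀ D : ℕ → ℝ, (∀ N : ℕ, Filter.Tendsto (fun δ : ℝ => (Literature.MathematicalPhysics.KineticTheory.HeatConduction.pinnedChain ω₂ lam β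 γ).totalCurrent (μ N (T + δ / 2) (T - δ / 2)) / δ) (nhdsWithin 0 {(0 : ℝ)}ᶜ) (nhds (D N))) → ∃ c : ℝ, 0 < c ∧ ∀ᶠ N : ℕ in Filter.atTop, c ≤ D N

/-- item stmt-AtomisticToContinuum-24582 · support · rank 9 · open · by planner
sources: CuneoEckmannHairerReyBellet2018, EckmannPilletReyBellet1999
[support] finite-N NESS uniqueness for the pinned chain at all positive parameters and bath
temperatures (verbatim LocalOhmBV.NessUnique, stmt-0741, PROVED). PIECE TAG COSTUME(cite:
NessUnique_holds); critic row 5 ✓. [difficulty: provable-now] -/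
@[route_item "route-AtomisticToContinuum-ResponseFloorAndLimit", crux]
def NessUnique : Prop :=
  ∀ ω₂ lam β γ : ℝ, 0 < ω₂ → 0 < lam → 0 < β → 0 < γ → ∀ (N : ℕ) (T_L T_R : ℝ), 0 < T_L → 0 < T_R → ∀ μ ν : MeasureTheory.Measure (Literature.MathematicalPhysics.KineticTheory.HeatConduction.PhaseSpace N), (Literature.MathematicalPhysics.KineticTheory.HeatConduction.pinnedChain ω₂ lam β γ).IsSteadyState N T_L T_R μ → (Literature.MathematicalPhysics.KineticTheory.HeatConduction.pinnedChain ω₂ lam β γ).IsSteadyState N T_L T_R ν → μ = ν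

/-- item stmt-AtomisticToContinuum-24583 · support · rank 9 · open · by planner
sources: EckmannPilletReyBellet1999, CuneoEckmannHairerReyBellet2018
[support] finite-N NESS existence (verbatim LocalOhmBV.PinnedSteadyStateExists, stmt-9900, PROVED).
PIECE TAG COSTUME(cite: the landed proof of 9900); critic row 5 ✓. [difficulty: provable-now] -/
@[route_item "route-AtomisticToContinuum-ResponseFloorAndLimit", crux]
def PinnedSteadyStateExists : Prop :=
  ∀ ω₂ lam β γ : ℝ, 0 < ω₂ → 0 < lam → 0 < β → 0 < γ → ∀ (N : ℕ) (T_L T_R : ℝ), 0 < T_L → 0 < T_R → ∃ μ : MeasureTheory.Measure (Literature.MathematicalPhysics.KineticTheory.HeatConduction.PhaseSpace N), (Literature.MathematicalPhysics.KineticTheory.HeatConduction.pinnedChain ω₂ lam β γ).IsSteadyState N T_L T_R μ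

/-- item stmt-AtomisticToContinuum-24584 · support · rank 9 · open · by planner
sources: BonettoLebowitzReyBellet2000
[support] existence of the finite-N response coefficient D_N(T) along every steady-state family
under uniqueness (verbatim LocalOhmBV.FiniteResponseOfUnique, stmt-0717, PROVED). PIECE TAG
COSTUME(cite: the landed proof of 0717); critic row 5 ✓. [difficulty: provable-now] -/
@[route_item "route-AtomisticToContinuum-ResponseFloorAndLimit", crux]
def FiniteResponseOfUnique : Prop :=
  ∀ ω₂ lam β γ : ℝ, 0 < ω₂ → 0 < lam → 0 < β → 0 < γ → (∀ (N : ℕ) (T_L T_R : ℝ), 0 < T_L → 0 < T_R → ∀ μ ν : MeasureTheory.Measure (Literature.MathematicalPhysics.KineticTheory.HeatConduction.PhaseSpace N), (Literature.MathematicalPhysics.KineticTheory.HeatConduction.pinnedChain ω₂ lam β γ).IsSteadyState N T_L T_R μ → (Literature.MathematicalPhysics.KineticTheory.HeatConduction.pinnedChain ω₂ lam β γ).IsSteadyState N T_L T_R ν → μ = ν) → ∀ μ : (N : ℕ) → ℝ → ℝ → MeasureTheory.Measure (Literature.MathematicalPhysics.KineticTheory.HeatConduction.PhaseSpace N), (∀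 (N : ℕ) (T_L T_R : ℝ), 0 < T_L → 0 < T_R → (Literature.MathematicalPhysics.KineticTheory.HeatConduction.pinnedChain ω₂ lam β γ).IsSteadyState N T_L T_R (μ N T_L T_R)) → ∀ T : ℝ, 0 < T → ∀ N : ℕ, ∃ D : ℝ, Filter.Tendsto (fun δ : ℝ => (Literature.MathematicalPhysics.KineticTheory.HeatConduction.pinnedChain ω₂ lam β γ).totalCurrent (μ N (T + δ / 2) (T - δ / 2)) / δ) (nhdsWithin 0 {(0 : ℝ)}ᶜ) (nhds D)

/-- item stmt-AtomisticToContinuum-24585 · assembly · rank 1 · open · by planner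
sources: BonettoLebowitzReyBellet2000
[assembly] NessUnique → PinnedSteadyStateExists → FiniteResponseOfUnique → BoundedResponse →
ResponseLimitExists → ResponseEventuallyPositive → FouriersLaw. -/
@[route_item "route-AtomisticToContinuum-ResponseFloorAndLimit"]
def Assembly : Prop :=
  NessUnique → PinnedSteadyStateExists → FiniteResponseOfUnique → BoundedResponse → ResponseLimitExists → ResponseEventuallyPositive → _root_.FouriersLaw

/-! D-0027 §2.1 — DECIDING THEOREM (planner-authored via `route open/edit --closes-file`; by planner-decomp-a2c-writer-1-g0-0 2026-08-30T01:52:52Z):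
its hypotheses are this route's items and its conclusion the sub-problem Statement (glue_lint), and it elaborates with this file. -/

@[closes "route-AtomisticToContinuum-ResponseFloorAndLimit"] theorem closes (hNU : NessUnique) (hEX : PinnedSteadyStateExists) (hFR : FiniteResponseOfUnique)
    (hBR : BoundedResponse) (hL : ResponseLimitExists) (hP : ResponseEventuallyPositive) :
    _root_.FouriersLaw := by
  show Literature.MathematicalPhysics.KineticTheory.HeatConduction.FouriersLaw
  intro ω₂ lam β γ hω hl hβ hγ
  have hUq := hNU ω₂ lam β γ hω hl hβ hγ
  -- bounded response along every steady-state family (item `BoundedResponse`, now a DIRECT binder)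
  have hB := hBR ω₂ lam β γ hω hl hβ hγ hUq
  -- clause (i) existence: the support item `PinnedSteadyStateExists`
  have hex : ∀ (N : ℕ) (T_L T_R : ℝ), 0 < T_L → 0 < T_R →
      ∃ μ : MeasureTheory.Measure (Literature.MathematicalPhysics.KineticTheory.HeatConduction.PhaseSpace N),
        (Literature.MathematicalPhysics.KineticTheory.HeatConduction.pinnedChain ω₂ lam β γ).IsSteadyState N T_L T_R μ :=
    fun N T_L T_R h1 h2 => hEX ω₂ lam β γ hω hl hβ hγ N T_L T_R h1 h2
  refine ⟨fun N T_L T_R h1 h2 => ?_, ?_⟩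
  · obtain ⟨μ, hμ⟩ := hex N T_L T_R h1 h2
    exact ⟨μ, hμ, fun ν hν => hUq N T_L T_R h1 h2 ν μ hν hμ⟩
  classical
  let μ₀ : (N : ℕ) → ℝ → ℝ →
      MeasureTheory.Measure (Literature.MathematicalPhysics.KineticTheory.HeatConduction.PhaseSpace N) :=
    fun N T_L T_R => if h : 0 < T_L ∧ 0 < T_R then Classical.choose (hex N T_L T_R h.1 h.2) else 0
  have hμ₀ : ∀ (N : ℕ) (T_L T_R : ℝ), 0 < T_L → 0 < T_R →
      (Literature.MathematicalPhysics.KineticTheory.HeatConduction.pinnedChain ω₂ lam β γ).IsSteadyState N T_L T_R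
        (μ₀ N T_L T_R) := by
    intro N T_L T_R h1 h2
    have h12 : 0 < T_L ∧ 0 < T_R := ⟨h1, h2⟩
    simp only [μ₀, dif_pos h12]
    exact Classical.choose_spec (hex N T_L T_R h1 h2)
  have hD : ∀ T : ℝ, 0 < T → ∀ N : ℕ, ∃ D : ℝ,
      Filter.Tendsto (fun δ : ℝ =>
        (Literature.MathematicalPhysics.KineticTheory.HeatConduction.pinnedChain ω₂ lam β γ).totalCurrent
          (μ₀ N (T + δ / 2) (T - δ / 2)) / δ) (nhdsWithin 0 {(0 : ℝ)}ᶜ) (nhds D) :=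
    fun T hT N => hFR ω₂ lam β γ hω hl hβ hγ hUq μ₀ hμ₀ T hT N
  let D₀ : ℝ → ℕ → ℝ := fun T N => if hT : 0 < T then Classical.choose (hD T hT N) else 0
  have hD₀ : ∀ T : ℝ, 0 < T → ∀ N : ℕ,
      Filter.Tendsto (fun δ : ℝ =>
        (Literature.MathematicalPhysics.KineticTheory.HeatConduction.pinnedChain ω₂ lam β γ).totalCurrent
          (μ₀ N (T + δ / 2) (T - δ / 2)) / δ) (nhdsWithin 0 {(0 : ℝ)}ᶜ) (nhds (D₀ T N)) := by
    intro T hT N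
    simp only [D₀, dif_pos hT]
    exact Classical.choose_spec (hD T hT N)
  have hbdd : ∀ T : ℝ, 0 < T → BddAbove (Set.range fun N => |D₀ T N|) :=
    fun T hT => hB μ₀ hμ₀ T hT (D₀ T) (hD₀ T hT)
  -- existence of the limit (item `ResponseLimitExists`) + uniform eventual floor (item `ResponseEventuallyPositive`)
  have hconv : ∀ T : ℝ, 0 < T → ∃ k : ℝ, 0 < k ∧ Filter.Tendsto (D₀ T) Filter.atTop (nhds k) := by
    intro T hT
    obtain ⟨k, hk⟩ := hL ω₂ lam β γ hω hl hβ hγ hUq μ₀ hμ₀ T hT (D₀ T) (hD₀ T hT) (hbdd T hT)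
    obtain ⟨c, hc, hev⟩ := hP ω₂ lam β γ hω hl hβ hγ hUq μ₀ hμ₀ T hT (D₀ T) (hD₀ T hT)
    exact ⟨k, lt_of_lt_of_le hc (ge_of_tendsto hk hev), hk⟩
  let κ : ℝ → ℝ := fun T => if hT : 0 < T then Classical.choose (hconv T hT) else 1
  refine ⟨κ, fun T hT => ?_, ?_⟩
  · simp only [κ, dif_pos hT]
    exact (Classical.choose_spec (hconv T hT)).1
  intro μ hμ T hT
  refine ⟨D₀ T, fun N => ?_, ?_⟩
  · have key : ∀ᶠ δ in nhdsWithin (0 : ℝ) {(0 : ℝ)}ᶜ,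
        (Literature.MathematicalPhysics.KineticTheory.HeatConduction.pinnedChain ω₂ lam β γ).totalCurrent
            (μ₀ N (T + δ / 2) (T - δ / 2)) / δ =
          (Literature.MathematicalPhysics.KineticTheory.HeatConduction.pinnedChain ω₂ lam β γ).totalCurrent
            (μ N (T + δ / 2) (T - δ / 2)) / δ := by
      have h2 : ∀ᶠ δ in nhds (0 : ℝ), δ < 2 * T := eventually_lt_nhds (by linarith)
      have h2' : ∀ᶠ δ in nhds (0 : ℝ), -(2 * T) < δ := eventually_gt_nhds (by linarith)
      filter_upwards [mem_nhdsWithin_of_mem_nhds h2, mem_nhdsWithin_of_mem_nhds h2'] with δ hlt hgt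
      have ha : 0 < T + δ / 2 := by linarith
      have hb : 0 < T - δ / 2 := by linarith
      rw [hUq N _ _ ha hb _ _ (hμ₀ N _ _ ha hb) (hμ N _ _ ha hb)]
    exact (hD₀ T hT N).congr' key
  · simp only [κ, dif_pos hT]
    exact (Classical.choose_spec (hconv T hT)).2

end Summit.AtomisticToContinuum.FouriersLaw.Theses.ResponseFloorAndLimit
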